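import Mathlib
import HarnessLib
import Summits.HubbardSuperconductivity.HubbardSuperconductivity.Theorems.KLProgrammeKLRegimeSplitBundleV7

/-!
# Route `KLProgramme`, crux K3 (stmt-HubbardSuperconductivity-19937), child 2 `KLRegimeCounterterm` at the V7 bundle — the VOLUME
# TRANSFER: a frame renormalised WITH MARGIN at ONE volume `(L₀, M₀)` is renormalised at EVERY larger volume, by (E3f)
# `TwoLegVolumeRate` read AT THE CONSTRUCTION VOLUME (defect Δ14; p1b g4's XREAD route, STATUS 2026-08-26 14:08:20Z)

Cell gate-hubbard-kl, seat p1b (g4).  `CountertermP2 klPredsV7 W` (`…SplitGenericV2`/`…SplitGenericV3`) hands the child-2 prover, for every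
admissible frame `K`, the per-scale slots `engine ∧ twoLeg ∧ split` at EVERY volume `(L, M)` beyond the hypothesis thresholds `(Lh, Mh)`,
at every scale `n ≤ N = nScales β`, given the renormalisation of `K` at that volume below `n`; it asks for ONE frame renormalised at all
volumes beyond output thresholds `(Lc, Mc)`.  Since `RenormalisedAtF L M … K R n` (`|ν_n^{L,M}(K)(θ)| ≤ cr·|U|·Λ_n²/e₀`, `…SplitTwoLegF`)
depends on the volume ONLY through the local part `klLocalPart L M`, the V7 two-leg clause (E3f) — `|ν_n^{L,M}(K)(θ) − ν_n^{L′,M′}(K)(θ)| ≤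
Q.CL β n / L` for `L ≤ L′`, `Q.M0 β L′ ≤ M′`, given the non-self history of `K` at `(L′, M′)` below `n` — transfers renormalisation from
the construction volume to all larger ones by an UPWARD INDUCTION ON `n` AT THE TARGET VOLUME: the induction hypothesis (renormalisation
at `(L, M)` below `n`) fed to the hypothesis block at `(L, M)` yields `split ∧ engine ∧ twoLeg` there below `n`, i.e. exactly (E3f)'s
comparison-volume antecedent `histV7 ∧ TwoLegStepG histV7`; (E3f) is then invoked at `(L₀, M₀, n)` (where the history holds by
construction) with comparison volume `(L, M)`.  No comparison of two different fixed points, no contraction across volumes.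
So child 2 at V7 = a single-volume fixed point with margin (`|ν_n^{L₀,M₀}| + Q.CL β n/L₀ ≤ cr·|U|·Λ_n²/e₀`, e.g. half/half:
`renormMargin_of_half`, `exists_nat_forall_div_le` for the choice of `L₀`) + `klPredsV7_renorm_allVolumes` /
`klPredsV7_counterterm_thresholds` (the `∃ Lc Mc` form of `CountertermP2`'s conclusion).  Pure logic over the V7 slots; nothing is
asserted about the model.
-/

noncomputable section

namespace Summit.HubbardSuperconductivity.HubbardSuperconductivity.Theorems.KLRegimeSplit

set_option linter.dupNamespace false -- summit = problem name (single-conjunct summit), D-0017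

open Finset Literature.MathematicalPhysics.QuantumLattice Literature.Probability.LatticeModels
open Summit.HubbardSuperconductivity.HubbardSuperconductivity.Theorems.KLProgrammeLegKernels

/-! ## §1 The transfer -/

/-- **Volume transfer of renormalisation at the V7 bundle.**  Let `K` carry child 2's hypothesis block beyond `(Lh, Mh)` up to scale `N`
(the slots of `klPredsV7`: `engine ∧ twoLeg ∧ split` at `(L, M, n)` given `renorm` at `(L, M)` below `n`), and let `K` be renormalised WITH
MARGIN at one volume `(L₀, M₀)` beyond `(Lh, Mh)` and beyond the Matsubara threshold `Q.M0 β L₀`: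
`|ν_n^{L₀,M₀}(K)(θ)| + Q.CL β n / L₀ ≤ cr·|U|·Λ_n²/e₀` for all `n ≤ N`, `θ`.  Then `K` is renormalised (`RenormalisedAtF`) at every scale
`n ≤ N` at every volume `(L, M)` with `L₀ ≤ L`, `Mh L ≤ M`, `Q.M0 β L ≤ M`. -/
theorem klPredsV7_renorm_allVolumes {G : GeoConsts} {P : SplitConsts} {Q : EngConsts} {R : RenConsts} {β U μ : ℝ}
    {K : TrigPolyC4v} {N Lh : ℕ} {Mh : ℕ → ℕ}
    (hyp : ∀ (L M : ℕ) [NeZero L] [NeZero M], Lh ≤ L → Mh L ≤ M →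
      ∀ n : ℕ, n ≤ N → (∀ j < n, klPredsV7.renorm L M β U μ K R j) →
        klPredsV7.engine L M G P Q β U μ K n ∧ klPredsV7.twoLeg L M G P Q R β U μ K n ∧ klPredsV7.split L M G P Q β U μ K n)
    (hCL : ∀ n, 0 ≤ Q.CL β n) {L₀ M₀ : ℕ} [NeZero L₀] [NeZero M₀] (hL₀ : Lh ≤ L₀) (hM₀ : Mh L₀ ≤ M₀) (hM₀' : Q.M0 β L₀ ≤ M₀)
    (hdeep : ∀ n ≤ N, ∀ θ : ℝ,
      |klLocalPart L₀ M₀ β U μ K n θ| + Q.CL β n / L₀ ≤ R.cr * |U| * klScale klE0 n ^ 2 / klE0) :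
    ∀ (L M : ℕ) [NeZero L] [NeZero M], L₀ ≤ L → Mh L ≤ M → Q.M0 β L ≤ M →
      ∀ n : ℕ, n ≤ N → RenormalisedAtF L M β U μ K R n := by
  -- renormalisation at the construction volume itself (drop the nonnegative margin)
  have hren₀ : ∀ n ≤ N, RenormalisedAtF L₀ M₀ β U μ K R n := fun n hn θ =>
    le_trans (le_add_of_nonneg_right (div_nonneg (hCL n) (Nat.cast_nonneg L₀))) (hdeep n hn θ)
  intro L M _ _ hL hM hM0 n
  induction n using Nat.strong_induction_on with
  | _ n ih =>
    intro hn
    have hLh : Lh ≤ L := hL₀.trans hL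
    -- (E3f)'s comparison-volume antecedent at the TARGET volume below `n`, from the induction hypothesis and the hypothesis block there
    have hhist : ∀ j < n, histV7 L M G P Q R β U μ K j ∧ TwoLegStepG L M (histV7 L M G P Q R β U μ) G P Q R β U μ K j := by
      intro j hj
      have hjN : j ≤ N := (le_of_lt hj).trans hn
      have hrenj : ∀ i < j, klPredsV7.renorm L M β U μ K R i := fun i hi => ih i (hi.trans hj) ((le_of_lt (hi.trans hj)).trans hn)
      obtain ⟨hE, hT, hS⟩ := hyp L M hLh hM j hjN hrenj
      exact ⟨⟨hS, ih j hj hjN, hE⟩, hT.1⟩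
    -- the two-leg slot at the CONSTRUCTION volume at scale `n` (history there by `hren₀`), and its volume-rate clause towards `(L, M)`
    obtain ⟨-, hT₀, -⟩ := hyp L₀ M₀ hL₀ hM₀ n hn (fun j hj => hren₀ j ((le_of_lt hj).trans hn))
    have hrate : ∀ θ : ℝ, |klLocalPart L₀ M₀ β U μ K n θ - klLocalPart L M β U μ K n θ| ≤ Q.CL β n / L₀ :=
      hT₀.2 hM₀' L M hL hM0 hhist
    intro θ
    have h1 := hrate θ
    have h2 := hdeep n hn θ
    have h3 : |klLocalPart L M β U μ K n θ| - |klLocalPart L₀ M₀ β U μ K n θ| ≤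
        |klLocalPart L M β U μ K n θ - klLocalPart L₀ M₀ β U μ K n θ| := abs_sub_abs_le_abs_sub _ _
    rw [abs_sub_comm] at h3
    linarith

/-- **The same in the shape of `CountertermP2`'s conclusion**: output thresholds `Lc := L₀`, `Mc L := max (Mh L) (Q.M0 β L)`. -/
theorem klPredsV7_counterterm_thresholds {G : GeoConsts} {P : SplitConsts} {Q : EngConsts} {R : RenConsts} {β U μ : ℝ}
    {K : TrigPolyC4v} {N Lh : ℕ} {Mh : ℕ → ℕ}
    (hyp : ∀ (L M : ℕ) [NeZero L] [NeZero M], Lh ≤ L → Mh L ≤ M →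
      ∀ n : ℕ, n ≤ N → (∀ j < n, klPredsV7.renorm L M β U μ K R j) →
        klPredsV7.engine L M G P Q β U μ K n ∧ klPredsV7.twoLeg L M G P Q R β U μ K n ∧ klPredsV7.split L M G P Q β U μ K n)
    (hCL : ∀ n, 0 ≤ Q.CL β n) {L₀ M₀ : ℕ} [NeZero L₀] [NeZero M₀] (hL₀ : Lh ≤ L₀) (hM₀ : Mh L₀ ≤ M₀) (hM₀' : Q.M0 β L₀ ≤ M₀)
    (hdeep : ∀ n ≤ N, ∀ θ : ℝ,
      |klLocalPart L₀ M₀ β U μ K n θ| + Q.CL β n / L₀ ≤ R.cr * |U| * klScale klE0 n ^ 2 / klE0) :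
    ∃ (Lc : ℕ) (Mc : ℕ → ℕ), ∀ (L M : ℕ) [NeZero L] [NeZero M], Lc ≤ L → Mc L ≤ M →
      ∀ n : ℕ, n ≤ N → klPredsV7.renorm L M β U μ K R n :=
  ⟨L₀, fun L => max (Mh L) (Q.M0 β L), fun L M _ _ hL hM n hn =>
    klPredsV7_renorm_allVolumes hyp hCL hL₀ hM₀ hM₀' hdeep L M hL ((le_max_left _ _).trans hM) ((le_max_right _ _).trans hM) n hn⟩

/-! ## §2 Bookkeeping for the margin (half for the fixed point, half for the volume rate) -/

/-- **Half/half margin**: renormalisation at `(L₀, M₀)` within HALF the tolerance and a volume-rate budget `Q.CL β n / L₀` within the other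
half give the margin hypothesis of `klPredsV7_renorm_allVolumes`. -/
theorem renormMargin_of_half {Q : EngConsts} {R : RenConsts} {β U μ : ℝ} {K : TrigPolyC4v} {N L₀ M₀ : ℕ} [NeZero L₀] [NeZero M₀]
    (hhalf : ∀ n ≤ N, ∀ θ : ℝ, |klLocalPart L₀ M₀ β U μ K n θ| ≤ R.cr * |U| * klScale klE0 n ^ 2 / klE0 / 2)
    (hvol : ∀ n ≤ N, Q.CL β n / L₀ ≤ R.cr * |U| * klScale klE0 n ^ 2 / klE0 / 2) :
    ∀ n ≤ N, ∀ θ : ℝ, |klLocalPart L₀ M₀ β U μ K n θ| + Q.CL β n / L₀ ≤ R.cr * |U| * klScale klE0 n ^ 2 / klE0 := by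
  intro n hn θ
  have h1 := hhalf n hn θ
  have h2 := hvol n hn
  linarith

/-- **Choice of the construction volume**: finitely many budgets `a n / L ≤ t n` (`n ≤ N`, `t n > 0`) hold for all `L` beyond one
threshold `L₁` (take `L₁ = ⌈Σ_{n ≤ N} |a n| / t n⌉₊ + 1`). -/
theorem exists_nat_forall_div_le (N : ℕ) (a t : ℕ → ℝ) (ht : ∀ n ≤ N, 0 < t n) :
    ∃ L₁ : ℕ, ∀ L : ℕ, L₁ ≤ L → ∀ n ≤ N, a n / (L : ℝ) ≤ t n := by
  refine ⟨⌈∑ m ∈ range (N + 1), |a m| / t m⌉₊ + 1, fun L hL n hn => ?_⟩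
  have hL1 : (1 : ℝ) ≤ L := by exact_mod_cast (Nat.le_add_left 1 _).trans hL
  have hLpos : (0 : ℝ) < L := by linarith
  have hsum : ∑ m ∈ range (N + 1), |a m| / t m ≤ (L : ℝ) := by
    have h1 : (∑ m ∈ range (N + 1), |a m| / t m) ≤ (⌈∑ m ∈ range (N + 1), |a m| / t m⌉₊ : ℝ) := Nat.le_ceil _
    have h2 : ((⌈∑ m ∈ range (N + 1), |a m| / t m⌉₊ + 1 : ℕ) : ℝ) ≤ L := by exact_mod_cast hL
    push_cast at h2
    linarith
  have hmem : n ∈ range (N + 1) := mem_range.2 (Nat.lt_succ_of_le hn)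
  have hterm : |a n| / t n ≤ ∑ m ∈ range (N + 1), |a m| / t m :=
    single_le_sum (f := fun m => |a m| / t m) (fun m hm => by
      have hm' : m ≤ N := Nat.lt_succ_iff.mp (mem_range.1 hm)
      exact div_nonneg (abs_nonneg _) (ht m hm').le) hmem
  have htn := ht n hn
  have hkey : |a n| ≤ t n * L := by
    have : |a n| / t n ≤ L := hterm.trans hsum
    rwa [div_le_iff₀ htn, mul_comm] at this
  rw [div_le_iff₀ hLpos]
  exact (le_abs_self _).trans hkey

/-- **The volume-rate half of the margin is available beyond one threshold**: if the tolerances are positive (`0 < cr`, `U ≠ 0`), there is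
`L₁` with `Q.CL β n / L ≤ cr·|U|·Λ_n²/e₀/2` for all `L ≥ L₁`, `n ≤ N`. -/
theorem exists_volumeRate_half {Q : EngConsts} {R : RenConsts} (β : ℝ) {U : ℝ} (N : ℕ) (hcr : 0 < R.cr) (hU : U ≠ 0) :
    ∃ L₁ : ℕ, ∀ L : ℕ, L₁ ≤ L → ∀ n ≤ N, Q.CL β n / (L : ℝ) ≤ R.cr * |U| * klScale klE0 n ^ 2 / klE0 / 2 := by
  refine exists_nat_forall_div_le N (fun n => Q.CL β n) (fun n => R.cr * |U| * klScale klE0 n ^ 2 / klE0 / 2) fun n _ => ?_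
  have hΛ : 0 < klScale klE0 n := by unfold klScale klE0; positivity
  have he : 0 < klE0 := by unfold klE0; norm_num
  have hUa : 0 < |U| := abs_pos.2 hU
  positivity

end Summit.HubbardSuperconductivity.HubbardSuperconductivity.Theorems.KLRegimeSplit

end
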